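import Mathlib
import HarnessLib
import Literature.MathematicalPhysics.QuantumFieldTheory.ConstructiveQFTWave0
import Summits.Ventures.LatticeQCDFlow.Scaling.LatticeEntropy
import Summits.Ventures.LatticeQCDFlow.Scaling.LatticeGibbs
import Summits.Ventures.LatticeQCDFlow.Scaling.ExactTransportVolume

/-!
# LatticeQCDFlow / Scaling — the ONE-SIDED transport items (C2a-E)/(C2a-C) typed, and row 30's two density-ratio steps isolated

HONEST FRAMING: exact (Metropolis-corrected) sampling algorithms for lattice gauge theory; figures of merit are
autocorrelation/cost numbers at stated couplings and volumes; no continuum-physics claim.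

Venture `LatticeQCDFlow` (cell pub-lqcd), topic `Scaling`, FANOUT row 29 (theory-2) — OUR WORK (THEORY-2.md §3.3,
v2.6 "one-sided transport laws"; file 1 of 3, the laws are `Scaling/ExactTransportOneSided.lean`, the `U(1)/U(N)/SU(N)`
instances `Scaling/ExactTransportOneSidedInstances.lean`).  Contents:

* §0 the two items `ExactTransportExpansion d N G ρ` (`Lip(T) ≥ e^{cβ}` for every exact LIPSCHITZ transport
  `T_*Haar^{⊗E} = μ_{Λ,β}`, `L ≥ 2`, uniformly in `L`) and `ExactTransportContraction d N G ρ`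
  (`log coLip(T) ≥ c·log β - C` for every exact CO-LIPSCHITZ transport, `L ≥ L₀`) — the two halves of row 30's
  (C2a) `Conjectures.ExactTransportBiLipschitz` (`Lip·coLip ≥ e^{cβ}`), `@[conjecture]`-tagged and PROVED in file 2;
* §1 the tools: `exists_radius_action_le` (a sup-ball about the identity configuration of radius `r₀(ρ, η)`
  INDEPENDENT OF THE VOLUME on which every plaquette costs `≤ η` — continuity of
  `(g₁,…,g₄) ↦ N - Re tr ρ(g₁g₂g₃⁻¹g₄⁻¹)` at `1 ∈ G⁴`), `le_partitionFunction_of_ball`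
  (`Z ≥ e^{-βs₂}·π(B̄(1,r₀))`), `aemeasurable_of_map_eq` (exactness forces a.e.-measurability),
  `exists_apply_mem_of_map_eq` (the image of an exact transport meets every non-empty open set),
  `exists_ne_one_of_ballVolumes`, and row 30's STEP 1 / STEP 2 of `exactTransportBiLipschitz_of_ballVolumes` as
  stand-alone lemmas — `log_partitionFunction_add_le`: `log Z + β·S(Tx) ≤ #E·(log(A/a) + κ·log K)` using ONLY
  `LipschitzWith K T`; `neg_log_partitionFunction_sub_le`: `-log Z - β·S(Tx) ≤ #E·(log(A/a) + κ·log K')` using ONLY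
  `AntilipschitzWith K' T` (proof text = row 30's, with `Measure.map_apply_of_aemeasurable`).

Elementary given the tree; nothing here is cited as a fact.
-/

noncomputable section

namespace Summit.Ventures.LatticeQCDFlow.Theory2.Lattice

open MeasureTheory Metric Set Literature.MathematicalPhysics.QuantumFieldTheory

/-! ## §0. The two one-sided items -/

section Defs

variable (d N : ℕ) (G : Type) [Group G] [MetricSpace G] [IsTopologicalGroup G] [CompactSpace G]
  [MeasurableSpace G] [BorelSpace G] (ρ : G →* Matrix (Fin N) (Fin N) ℂ)

/-- **(C2a-E) EXPANSION LAW** (OURS, THEORY-2.md §3.3 v2.6): there are `c > 0`, `β₀` such that for every `L ≥ 2`,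
every `β ≥ β₀` and every exact LIPSCHITZ transport `T` of `Haar^{⊗E}` onto `μ_{Λ,β}` (sup metric on `G^E`),
`Lip(T) ≥ e^{cβ}`.  Proved below for two-sided ball volumes and a non-constant character. [folklore] -/
@[conjecture]
def ExactTransportExpansion : Prop :=
  ∃ c : ℝ, 0 < c ∧ ∃ β₀ : ℝ, ∀ (L : ℕ) [NeZero L], 2 ≤ L → ∀ β : ℝ, β₀ ≤ β →
    ∀ (T : GaugeConfig d L G → GaugeConfig d L G) (K : NNReal), LipschitzWith K T →
      (Measure.pi fun _ : Edge d L => haarProbability G).map T = wilsonMeasure (d := d) (L := L) ρ β →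
      Real.exp (c * β) ≤ (K : ℝ)

/-- **(C2a-C) CONTRACTION LAW** (OURS, THEORY-2.md §3.3 v2.6): there are `c > 0`, `C`, `β₀`, `L₀` such that for
every `L ≥ L₀`, every `β ≥ β₀` and every exact CO-LIPSCHITZ transport `T` of `Haar^{⊗E}` onto `μ_{Λ,β}`,
`log coLip(T) ≥ c·log β - C`, i.e. `coLip(T) ≥ e^{-C}·β^c`.  Proved below from the Laplace half-mass law. [folklore] -/
@[conjecture]
def ExactTransportContraction : Prop :=
  ∃ c : ℝ, 0 < c ∧ ∃ C β₀ : ℝ, ∃ L₀ : ℕ, ∀ (L : ℕ) [NeZero L], L₀ ≤ L → ∀ β : ℝ, β₀ ≤ β →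
    ∀ (T : GaugeConfig d L G → GaugeConfig d L G) (K' : NNReal), AntilipschitzWith K' T →
      (Measure.pi fun _ : Edge d L => haarProbability G).map T = wilsonMeasure (d := d) (L := L) ρ β →
      c * Real.log β - C ≤ Real.log (K' : ℝ)

end Defs

/-! ## §1. A low-action ball about the identity, uniformly in the volume; bounds on `Z` -/

section Tools

variable {N : ℕ} {G : Type} [Group G] [MetricSpace G] [IsTopologicalGroup G] [CompactSpace G]
  [SecondCountableTopology G] [MeasurableSpace G] [BorelSpace G]
  (ρ : G →* Matrix (Fin N) (Fin N) ℂ)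

omit [CompactSpace G] [SecondCountableTopology G] [MeasurableSpace G] [BorelSpace G] in
/-- **Uniform low-action ball.**  For continuous `ρ` and `η > 0` there is `r₀ ∈ (0,1]`, INDEPENDENT OF THE VOLUME,
such that every configuration within sup-distance `r₀` of the identity configuration has every plaquette cost
`≤ η`, hence `S ≤ η·#plaquettes` (continuity of `(g₁,g₂,g₃,g₄) ↦ N - Re tr ρ(g₁g₂g₃⁻¹g₄⁻¹)` at `1 ∈ G⁴`). [folklore] -/
theorem exists_radius_action_le (hρ : Continuous (ρ : G → Matrix (Fin N) (Fin N) ℂ)) {η : ℝ} (hη : 0 < η) :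
    ∃ r₀ : ℝ, 0 < r₀ ∧ r₀ ≤ 1 ∧ ∀ (d L : ℕ) [NeZero L] (U : GaugeConfig d L G), dist U 1 ≤ r₀ →
      wilsonAction ρ U ≤ η * Fintype.card (Plaquette d L) := by
  set f : G × G × G × G → ℝ := fun q => (N : ℝ) - (ρ (q.1 * q.2.1 * q.2.2.1⁻¹ * q.2.2.2⁻¹)).trace.re with hf
  have hw : Continuous fun q : G × G × G × G => q.1 * q.2.1 * q.2.2.1⁻¹ * q.2.2.2⁻¹ := by fun_prop
  have hfc : Continuous f := continuous_const.sub (Complex.continuous_re.comp (hρ.comp hw).matrix_trace)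
  have hf1 : f 1 = 0 := by
    simp [hf, Matrix.trace_one]
  obtain ⟨δ, hδ, hδf⟩ := Metric.continuousAt_iff.1 (hfc.continuousAt (x := (1 : G × G × G × G))) η hη
  refine ⟨min 1 (δ / 2), lt_min one_pos (by positivity), min_le_left _ _, fun d L _ U hU => ?_⟩
  have hlink : ∀ e : Edge d L, dist (U e) 1 < δ := fun e =>
    lt_of_le_of_lt ((dist_le_pi_dist U 1 e).trans hU) (lt_of_le_of_lt (min_le_right _ _) (by linarith))
  have hp : ∀ p : Plaquette d L, (N : ℝ) - (ρ (plaquetteHolonomy U p.1 p.2.1.1 p.2.1.2)).trace.re ≤ η := by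
    intro p
    set q : G × G × G × G :=
      (U (p.1, p.2.1.1), U (p.1.shift p.2.1.1, p.2.1.2), U (p.1.shift p.2.1.2, p.2.1.1), U (p.1, p.2.1.2)) with hq
    have hqd : dist q 1 < δ := by
      simp only [hq, Prod.dist_eq, Prod.fst_one, Prod.snd_one, max_lt_iff]
      exact ⟨hlink _, hlink _, hlink _, hlink _⟩
    have h := hδf hqd
    rw [hf1, Real.dist_eq, sub_zero] at h
    have hfq : f q = (N : ℝ) - (ρ (plaquetteHolonomy U p.1 p.2.1.1 p.2.1.2)).trace.re := rfl
    rw [← hfq]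
    exact (le_abs_self _).trans h.le
  unfold wilsonAction
  calc ∑ p : Plaquette d L, ((N : ℝ) - (ρ (plaquetteHolonomy U p.1 p.2.1.1 p.2.1.2)).trace.re)
      ≤ ∑ _p : Plaquette d L, η := Finset.sum_le_sum fun p _ => hp p
    _ = η * Fintype.card (Plaquette d L) := by
        rw [Finset.sum_const, Finset.card_univ, nsmul_eq_mul, mul_comm]

omit [MetricSpace G] [IsTopologicalGroup G] [CompactSpace G] [SecondCountableTopology G] [MeasurableSpace G]
  [BorelSpace G] in
/-- The Wilson action of the identity configuration vanishes. [folklore] -/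
theorem wilsonAction_one {d L : ℕ} [NeZero L] : wilsonAction ρ (1 : GaugeConfig d L G) = 0 := by
  simp only [wilsonAction, plaquetteHolonomy, Pi.one_apply, mul_one, inv_one, map_one, Matrix.trace_one,
    Fintype.card_fin]
  simp

/-- **Lower bound on `Z` from a low-action ball about the identity**: if `S ≤ s₂` on `B̄(1, r₀)` then
`e^{-βs₂}·π(B̄(1,r₀)) ≤ Z_Λ(β)` (`β ≥ 0`). [folklore] -/
theorem le_partitionFunction_of_ball {d L : ℕ} [NeZero L] {β : ℝ} (hβ : 0 ≤ β) {r₀ s₂ : ℝ}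
    (hS : ∀ U : GaugeConfig d L G, dist U 1 ≤ r₀ → wilsonAction ρ U ≤ s₂) :
    ENNReal.ofReal (Real.exp (-(β * s₂))) *
        (Measure.pi fun _ : Edge d L => haarProbability G) (closedBall 1 r₀) ≤
      partitionFunction (d := d) (L := L) ρ β :=
  calc _ ≤ wilsonWeight (d := d) (L := L) ρ β (closedBall 1 r₀) :=
        le_wilsonWeight_of_le ρ hβ measurableSet_closedBall fun U hU => hS U (mem_closedBall.1 hU)
    _ ≤ wilsonWeight (d := d) (L := L) ρ β univ := measure_mono (subset_univ _)

/-- **Exactness forces a.e.-measurability**: if `T_*π = μ_{Λ,β}` (as measures, Mathlib's `Measure.map`) then `T`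
is `π`-a.e. measurable — otherwise `Measure.map T π = 0 ≠ μ_{Λ,β}`. [folklore] -/
theorem aemeasurable_of_map_eq {d L : ℕ} [NeZero L] (hρ : Continuous (ρ : G → Matrix (Fin N) (Fin N) ℂ))
    (htr : ∀ g, (ρ g).trace.re ≤ N) {β : ℝ} (hβ : 0 ≤ β) {T : GaugeConfig d L G → GaugeConfig d L G}
    (hmap : (Measure.pi fun _ : Edge d L => haarProbability G).map T = wilsonMeasure (d := d) (L := L) ρ β) :
    AEMeasurable T (Measure.pi fun _ : Edge d L => haarProbability G) := by
  by_contra h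
  have hZ0 : partitionFunction (d := d) (L := L) ρ β ≠ 0 := partitionFunction_ne_zero ρ hρ β
  have hZtop : partitionFunction (d := d) (L := L) ρ β ≠ ⊤ :=
    ne_top_of_le_ne_top ENNReal.one_ne_top (partitionFunction_le_one ρ htr hβ)
  have h1 : wilsonMeasure (d := d) (L := L) ρ β univ = 1 := by
    show ((partitionFunction ρ β)⁻¹ • wilsonWeight ρ β) univ = 1
    rw [Measure.smul_apply, smul_eq_mul]
    exact ENNReal.inv_mul_cancel hZ0 hZtop
  rw [← hmap, Measure.map_of_not_aemeasurable h] at h1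
  simp at h1

/-- **STEP 1 of row 30's density-ratio argument, isolated** (only the LIPSCHITZ side is used): for an exact
`K`-Lipschitz transport `T` (`K > 0`), two-sided ball volumes and `β ≥ 0`,
`log Z + β·S(Tx) ≤ #E·(log(A/a) + κ·log K)` at every `x`. [folklore] -/
theorem log_partitionFunction_add_le {d L : ℕ} [NeZero L]
    (hρ : Continuous (ρ : G → Matrix (Fin N) (Fin N) ℂ)) (htr : ∀ g, (ρ g).trace.re ≤ N)
    {κ : ℕ} {a A : ℝ} (ha : 0 < a) (hA : 0 < A)
    (hlo : ∀ (g : G) (r : ℝ), 0 < r → r ≤ 1 → a * r ^ κ ≤ (haarProbability G (closedBall g r)).toReal)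
    (hup : ∀ (g : G) (r : ℝ), 0 < r → (haarProbability G (closedBall g r)).toReal ≤ A * r ^ κ)
    {β : ℝ} (hβ0 : 0 ≤ β) {T : GaugeConfig d L G → GaugeConfig d L G} {K : NNReal} (hK0 : 0 < (K : ℝ))
    (hT : LipschitzWith K T)
    (hmap : (Measure.pi fun _ : Edge d L => haarProbability G).map T = wilsonMeasure (d := d) (L := L) ρ β)
    (x : GaugeConfig d L G) :
    Real.log (partitionFunction (d := d) (L := L) ρ β).toReal + β * wilsonAction ρ (T x) ≤
      Fintype.card (Edge d L) * (Real.log (A / a) + κ * Real.log K) := by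
  set π : Measure (GaugeConfig d L G) := Measure.pi fun _ : Edge d L => haarProbability G with hπ
  set S : GaugeConfig d L G → ℝ := wilsonAction (d := d) (L := L) ρ with hSdef
  have hScont : Continuous S := continuous_wilsonAction (d := d) (L := L) ρ hρ
  have hTm : Measurable T := hT.continuous.measurable
  set nE : ℕ := Fintype.card (Edge d L) with hnE
  have hZ0 : partitionFunction (d := d) (L := L) ρ β ≠ 0 := partitionFunction_ne_zero ρ hρ β
  have hZtop : partitionFunction (d := d) (L := L) ρ β ≠ ⊤ :=
    ne_top_of_le_ne_top ENNReal.one_ne_top (partitionFunction_le_one ρ htr hβ0)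
  set Z : ℝ := (partitionFunction (d := d) (L := L) ρ β).toReal with hZdef
  have hZpos : 0 < Z := ENNReal.toReal_pos hZ0 hZtop
  have hμT : ∀ B : Set (GaugeConfig d L G), MeasurableSet B →
      wilsonMeasure (d := d) (L := L) ρ β B = π (T ⁻¹' B) := fun B hB => by
    rw [← hmap, Measure.map_apply hTm hB]
  have hμW : ∀ B : Set (GaugeConfig d L G),
      wilsonMeasure (d := d) (L := L) ρ β B = (partitionFunction ρ β)⁻¹ * wilsonWeight ρ β B := fun B => by
    show ((partitionFunction ρ β)⁻¹ • wilsonWeight ρ β) B = _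
    rw [Measure.smul_apply, smul_eq_mul]
  refine le_of_forall_pos_le_add fun ε hε => ?_
  have hε' : 0 < ε / (β + 1) := by positivity
  have hβε : β * (ε / (β + 1)) ≤ ε := by
    rw [mul_div_assoc', div_le_iff₀ (by positivity)]; nlinarith
  obtain ⟨δ, hδ, hδS⟩ := Metric.continuous_iff.1 hScont (T x) (ε / (β + 1)) hε'
  set r : ℝ := min 1 (δ / (2 * K)) with hr
  have hr0 : 0 < r := lt_min one_pos (by positivity)
  have hr1 : r ≤ 1 := min_le_left _ _
  have hKr : K * r < δ := by
    have : r ≤ δ / (2 * K) := min_le_right _ _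
    calc (K : ℝ) * r ≤ K * (δ / (2 * K)) := mul_le_mul_of_nonneg_left this hK0.le
      _ = δ / 2 := by field_simp
      _ < δ := by linarith
  -- (i) lower volume of `B̄(x, r)`
  have h1 := pow_le_pi_closedBall ha.le hlo x hr0 hr1
  -- (ii) `π(B̄(x,r)) ≤ μ(B̄(Tx, K r))`
  have hsub : closedBall x r ⊆ T ⁻¹' closedBall (T x) (K * r) := fun u hu => by
    rw [mem_preimage, mem_closedBall]
    exact (hT.dist_le_mul u x).trans (mul_le_mul_of_nonneg_left (mem_closedBall.1 hu) K.coe_nonneg)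
  have h2 : π (closedBall x r) ≤ wilsonMeasure (d := d) (L := L) ρ β (closedBall (T x) (K * r)) := by
    rw [hμT _ measurableSet_closedBall]; exact measure_mono hsub
  -- (iii) `μ(B̄(Tx, Kr)) ≤ Z⁻¹ e^{-β(S(Tx) - ε)} (A (Kr)^κ)^{nE}`
  have hSB : ∀ U ∈ closedBall (T x) (K * r), S (T x) - ε / (β + 1) ≤ S U := fun U hU => by
    have hd : dist U (T x) < δ := lt_of_le_of_lt (mem_closedBall.1 hU) hKr
    have := hδS U hd
    rw [Real.dist_eq] at this
    linarith [(abs_lt.1 this).1]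
  have h3 := wilsonWeight_le_of_le ρ hβ0 measurableSet_closedBall hSB
  have h4 := pi_closedBall_le_pow hup (T x) (mul_pos hK0 hr0)
  have hfin : (partitionFunction (d := d) (L := L) ρ β)⁻¹ *
      (ENNReal.ofReal (Real.exp (-(β * (S (T x) - ε / (β + 1))))) * π (closedBall (T x) (K * r))) ≠ ⊤ :=
    ENNReal.mul_ne_top (ENNReal.inv_ne_top.2 hZ0) (ENNReal.mul_ne_top ENNReal.ofReal_ne_top (measure_ne_top _ _))
  have hchain : (π (closedBall x r)).toReal ≤
      Z⁻¹ * (Real.exp (-(β * (S (T x) - ε / (β + 1)))) * (A * (K * r) ^ κ) ^ nE) := by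
    have h5 : π (closedBall x r) ≤ (partitionFunction (d := d) (L := L) ρ β)⁻¹ *
        (ENNReal.ofReal (Real.exp (-(β * (S (T x) - ε / (β + 1))))) * π (closedBall (T x) (K * r))) :=
      h2.trans (by rw [hμW]; exact mul_le_mul' le_rfl h3)
    have h6 := ENNReal.toReal_mono hfin h5
    rw [ENNReal.toReal_mul, ENNReal.toReal_mul, ENNReal.toReal_inv, ENNReal.toReal_ofReal (Real.exp_pos _).le]
      at h6
    refine h6.trans (mul_le_mul_of_nonneg_left (mul_le_mul_of_nonneg_left h4 (Real.exp_pos _).le) ?_)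
    exact inv_nonneg.2 hZpos.le
  have h7 : (a * r ^ κ) ^ nE ≤
      Z⁻¹ * (Real.exp (-(β * (S (T x) - ε / (β + 1)))) * (A * (K * r) ^ κ) ^ nE) := h1.trans hchain
  have hlhs : 0 < (a * r ^ κ) ^ nE := by positivity
  have h8 := Real.log_le_log hlhs h7
  rw [Real.log_pow, Real.log_mul ha.ne' (pow_pos hr0 _).ne', Real.log_pow,
    Real.log_mul (inv_pos.2 hZpos).ne' (by positivity), Real.log_inv,
    Real.log_mul (Real.exp_pos _).ne' (by positivity), Real.log_exp, Real.log_pow,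
    Real.log_mul hA.ne' (by positivity), Real.log_pow, Real.log_mul hK0.ne' hr0.ne'] at h8
  rw [Real.log_div hA.ne' ha.ne']
  linarith only [h8, hβε]

/-- **STEP 2 of row 30's density-ratio argument, isolated** (only the CO-LIPSCHITZ side is used): for an exact
`K'`-co-Lipschitz transport `T` (`K' > 0`; measurability follows from exactness), two-sided ball volumes and
`β ≥ 0`, `-log Z - β·S(Tx) ≤ #E·(log(A/a) + κ·log K')` at every `x`. [folklore] -/
theorem neg_log_partitionFunction_sub_le {d L : ℕ} [NeZero L]
    (hρ : Continuous (ρ : G → Matrix (Fin N) (Fin N) ℂ)) (htr : ∀ g, (ρ g).trace.re ≤ N)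
    {κ : ℕ} {a A : ℝ} (ha : 0 < a) (hA : 0 < A)
    (hlo : ∀ (g : G) (r : ℝ), 0 < r → r ≤ 1 → a * r ^ κ ≤ (haarProbability G (closedBall g r)).toReal)
    (hup : ∀ (g : G) (r : ℝ), 0 < r → (haarProbability G (closedBall g r)).toReal ≤ A * r ^ κ)
    {β : ℝ} (hβ0 : 0 ≤ β) {T : GaugeConfig d L G → GaugeConfig d L G} {K' : NNReal} (hK'0 : 0 < (K' : ℝ))
    (hT' : AntilipschitzWith K' T)
    (hmap : (Measure.pi fun _ : Edge d L => haarProbability G).map T = wilsonMeasure (d := d) (L := L) ρ β)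
    (x : GaugeConfig d L G) :
    -Real.log (partitionFunction (d := d) (L := L) ρ β).toReal - β * wilsonAction ρ (T x) ≤
      Fintype.card (Edge d L) * (Real.log (A / a) + κ * Real.log K') := by
  set π : Measure (GaugeConfig d L G) := Measure.pi fun _ : Edge d L => haarProbability G with hπ
  set S : GaugeConfig d L G → ℝ := wilsonAction (d := d) (L := L) ρ with hSdef
  have hScont : Continuous S := continuous_wilsonAction (d := d) (L := L) ρ hρ
  have hTm : AEMeasurable T π := aemeasurable_of_map_eq ρ hρ htr hβ0 hmap
  set nE : ℕ := Fintype.card (Edge d L) with hnE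
  have hZ0 : partitionFunction (d := d) (L := L) ρ β ≠ 0 := partitionFunction_ne_zero ρ hρ β
  have hZtop : partitionFunction (d := d) (L := L) ρ β ≠ ⊤ :=
    ne_top_of_le_ne_top ENNReal.one_ne_top (partitionFunction_le_one ρ htr hβ0)
  set Z : ℝ := (partitionFunction (d := d) (L := L) ρ β).toReal with hZdef
  have hZpos : 0 < Z := ENNReal.toReal_pos hZ0 hZtop
  have hμT : ∀ B : Set (GaugeConfig d L G), MeasurableSet B →
      wilsonMeasure (d := d) (L := L) ρ β B = π (T ⁻¹' B) := fun B hB => by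
    rw [← hmap, Measure.map_apply_of_aemeasurable hTm hB]
  have hμW : ∀ B : Set (GaugeConfig d L G),
      wilsonMeasure (d := d) (L := L) ρ β B = (partitionFunction ρ β)⁻¹ * wilsonWeight ρ β B := fun B => by
    show ((partitionFunction ρ β)⁻¹ • wilsonWeight ρ β) B = _
    rw [Measure.smul_apply, smul_eq_mul]
  refine le_of_forall_pos_le_add fun ε hε => ?_
  have hε' : 0 < ε / (β + 1) := by positivity
  have hβε : β * (ε / (β + 1)) ≤ ε := by
    rw [mul_div_assoc', div_le_iff₀ (by positivity)]; nlinarith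
  obtain ⟨δ, hδ, hδS⟩ := Metric.continuous_iff.1 hScont (T x) (ε / (β + 1)) hε'
  set r : ℝ := min 1 (δ / 2) with hr
  have hr0 : 0 < r := lt_min one_pos (by positivity)
  have hr1 : r ≤ 1 := min_le_left _ _
  have hrδ : r < δ := lt_of_le_of_lt (min_le_right _ _) (by linarith)
  -- (i) `μ(B̄(Tx, r)) ≤ π(B̄(x, K' r)) ≤ (A (K' r)^κ)^{nE}`
  have hsub : T ⁻¹' closedBall (T x) r ⊆ closedBall x (K' * r) := fun u hu => by
    rw [mem_preimage, mem_closedBall] at hu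
    rw [mem_closedBall]
    exact (hT'.le_mul_dist u x).trans (mul_le_mul_of_nonneg_left hu K'.coe_nonneg)
  have h2 : wilsonMeasure (d := d) (L := L) ρ β (closedBall (T x) r) ≤ π (closedBall x (K' * r)) := by
    rw [hμT _ measurableSet_closedBall]; exact measure_mono hsub
  have h4 := pi_closedBall_le_pow hup x (mul_pos hK'0 hr0)
  -- (ii) `Z⁻¹ e^{-β(S(Tx)+ε)} (a r^κ)^{nE} ≤ μ(B̄(Tx, r))`
  have hSB : ∀ U ∈ closedBall (T x) r, S U ≤ S (T x) + ε / (β + 1) := fun U hU => by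
    have hd : dist U (T x) < δ := lt_of_le_of_lt (mem_closedBall.1 hU) hrδ
    have := hδS U hd
    rw [Real.dist_eq] at this
    linarith [(abs_lt.1 this).2]
  have h3 := le_wilsonWeight_of_le ρ hβ0 measurableSet_closedBall hSB
  have h1 := pow_le_pi_closedBall ha.le hlo (T x) hr0 hr1
  have hchain : Z⁻¹ * (Real.exp (-(β * (S (T x) + ε / (β + 1)))) * (a * r ^ κ) ^ nE) ≤
      (π (closedBall x (K' * r))).toReal := by
    have h5 : (partitionFunction (d := d) (L := L) ρ β)⁻¹ *
        (ENNReal.ofReal (Real.exp (-(β * (S (T x) + ε / (β + 1))))) * π (closedBall (T x) r)) ≤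
          π (closedBall x (K' * r)) :=
      le_trans (by rw [hμW]; exact mul_le_mul' le_rfl h3) h2
    have h6 := ENNReal.toReal_mono (measure_ne_top _ _) h5
    rw [ENNReal.toReal_mul, ENNReal.toReal_mul, ENNReal.toReal_inv, ENNReal.toReal_ofReal (Real.exp_pos _).le]
      at h6
    refine le_trans (mul_le_mul_of_nonneg_left (mul_le_mul_of_nonneg_left h1 (Real.exp_pos _).le) ?_) h6
    exact inv_nonneg.2 hZpos.le
  have h7 : Z⁻¹ * (Real.exp (-(β * (S (T x) + ε / (β + 1)))) * (a * r ^ κ) ^ nE) ≤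
      (A * (K' * r) ^ κ) ^ nE := hchain.trans h4
  have hlhs : 0 < Z⁻¹ * (Real.exp (-(β * (S (T x) + ε / (β + 1)))) * (a * r ^ κ) ^ nE) := by positivity
  have h8 := Real.log_le_log hlhs h7
  rw [Real.log_mul (inv_pos.2 hZpos).ne' (by positivity), Real.log_inv,
    Real.log_mul (Real.exp_pos _).ne' (by positivity), Real.log_exp, Real.log_pow,
    Real.log_mul ha.ne' (pow_pos hr0 _).ne', Real.log_pow, Real.log_pow,
    Real.log_mul hA.ne' (by positivity), Real.log_pow, Real.log_mul hK'0.ne' hr0.ne'] at h8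
  rw [Real.log_div hA.ne' ha.ne']
  linarith only [h8, hβε]

/-- The image of an exact transport meets every non-empty open set (`μ_{Λ,β}` charges open sets). [folklore] -/
theorem exists_apply_mem_of_map_eq {d L : ℕ} [NeZero L] (hρ : Continuous (ρ : G → Matrix (Fin N) (Fin N) ℂ))
    (htr : ∀ g, (ρ g).trace.re ≤ N) (htr' : ∀ g, -(N : ℝ) ≤ (ρ g).trace.re) {β : ℝ} (hβ : 0 ≤ β)
    {T : GaugeConfig d L G → GaugeConfig d L G}
    (hmap : (Measure.pi fun _ : Edge d L => haarProbability G).map T = wilsonMeasure (d := d) (L := L) ρ β)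
    {O : Set (GaugeConfig d L G)} (hO : IsOpen O) (hne : O.Nonempty) : ∃ x, T x ∈ O := by
  haveI : (haarProbability G).IsHaarMeasure := Measure.isHaarMeasure_haarMeasure _
  have hTm : AEMeasurable T (Measure.pi fun _ : Edge d L => haarProbability G) :=
    aemeasurable_of_map_eq ρ hρ htr hβ hmap
  have hpos : 0 < wilsonMeasure (d := d) (L := L) ρ β O :=
    wilsonMeasure_pos_of_pi_pos ρ htr htr' hβ hO.measurableSet
      (hO.measure_pos (Measure.pi fun _ : Edge d L => haarProbability G) hne)
  rw [← hmap, Measure.map_apply_of_aemeasurable hTm hO.measurableSet] at hpos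
  exact nonempty_of_measure_ne_zero hpos.ne'

omit [SecondCountableTopology G] in
/-- Two-sided ball volumes with `κ ≥ 1` force `G ≠ {1}` (a small ball about `1` has Haar mass `< 1`). [folklore] -/
theorem exists_ne_one_of_ballVolumes {κ : ℕ} (hκ : 0 < κ) {A : ℝ} (hA : 0 < A)
    (hup : ∀ (g : G) (r : ℝ), 0 < r → (haarProbability G (closedBall g r)).toReal ≤ A * r ^ κ) :
    ∃ g : G, g ≠ 1 := by
  by_contra h
  simp only [not_exists, ne_eq, not_not] at h
  set r : ℝ := min 1 (1 / (2 * A)) with hr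
  have hr0 : 0 < r := lt_min one_pos (by positivity)
  have hr1 : r ≤ 1 := min_le_left _ _
  have hball : closedBall (1 : G) r = univ := eq_univ_of_forall fun g => by
    rw [h g, mem_closedBall, dist_self]; exact hr0.le
  have h1 := hup 1 r hr0
  rw [hball, measure_univ, ENNReal.toReal_one] at h1
  have h2 : r ^ κ ≤ r := by
    calc r ^ κ ≤ r ^ 1 := pow_le_pow_of_le_one hr0.le hr1 hκ
      _ = r := pow_one r
  have h3 : A * r ≤ 1 / 2 := by
    have : r ≤ 1 / (2 * A) := min_le_right _ _
    calc A * r ≤ A * (1 / (2 * A)) := mul_le_mul_of_nonneg_left this hA.le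
      _ = 1 / 2 := by field_simp
  linarith [mul_le_mul_of_nonneg_left h2 hA.le]

end Tools

end Summit.Ventures.LatticeQCDFlow.Theory2.Lattice

end
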